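import Summits.ResolutionOfSingularities.ResolutionOfSingularities.Theorems.WeightedInvariantLocalWeightedDropNCResRegimeDefs
import Summits.ResolutionOfSingularities.ResolutionOfSingularities.Theorems.WeightedInvariantLocalWeightedDropNCDirectrixCutPhase

/-! # W4.3 / `LocalWeightedDrop` — line `directrix-cut`: EVERY UNARY VERTEX HAS A DIRECTRIX FORM, and the POSITION TRICHOTOMY (every `m`)

Helper file for crux `stmt-ResolutionOfSingularities-8899` (`WeightedInvariant.LocalWeightedDrop`), registered line of record `directrix-cut` v3f
(res-L1-w43-strat-1 `g9/directrix_cut_line_v3f.lean` 37b4c92427ddabdc) and its UNARY POSITION SPLIT (`g9/unary_position_split_v1.lean` 44515f1b12c79086, whose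
Part A this file is, verbatim up to the two `Decoration.` names).  Definition-free; three theorems:

* `cone_eq_of_hyperplane` — A FORM INVARIANT UNDER A HYPERPLANE OF TRANSLATIONS IS A POWER OF ONE COVECTOR: if the degree-`d` form `v ↦ in_d S (v)` on `k^N`
  is invariant under `N - 1` linearly independent translation vectors, then `in_d S (v) = λ · (ℓ · v)^d` with `ℓ ≠ 0` vanishing on them
  (`WildPurePower.cone_eq_of_wide` is `N = 3` with the cross product; here `Submodule.exists_le_ker_of_lt_top` + `finrank` + the homogeneity lemmas
  `AxisNormalize.initEval_add_smul / initEval_smul`).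
* `Decoration.exists_isDirForm_of_unaryVertex` — an admissible UNARY vertex (`UnaryVertex δ`: `m` independent invariance vectors of `in_c(f · ∏_{l∈O} x_l)`)
  with `o ≥ 1` has a DIRECTRIX FORM (`Decoration.IsDirForm`, …NCResRegimeDefs); `λ ≠ 0` by `TOT2Near.order_ne_of_forall_inv` + `Decoration.order_totalO`
  (this is `Decoration.exists_isDirForm_of_not_hCol` for every `m`).
* `Decoration.position_trichotomy` — with `O = ∅` and a directrix form, the state is in GOOD, LETTER or BAD position (`GoodDir ∨ (∃ l, LetterDir l) ∨ BadDir`).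

Sources: OURS (elementary linear algebra over the tree's definitions); the positions are CJS's transversality cases (Cossart–Jannsen–Saito, LNM 2270 =
arXiv:0905.2191) as typed by res-L1-w43-lead-1 in …NCResRegimeDefs.
-/

set_option linter.dupNamespace false

namespace Summit.ResolutionOfSingularities.ResolutionOfSingularities.Theorems

namespace TameFourTupleDrop

open MvPowerSeries Literature.AlgebraicGeometry.Resolution

/-- **A FORM INVARIANT UNDER A HYPERPLANE OF TRANSLATIONS IS A POWER OF ONE COVECTOR** (every dimension): if the degree-`d` form `v ↦ in_d S (v)` on
`k^N` is invariant under `n = N - 1` linearly independent translation vectors `cv j`, then `in_d S (v) = λ · (ℓ · v)^d` with `ℓ ≠ 0` vanishing on every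
`cv j`.  (`WildPurePower.cone_eq_of_wide` is `N = 3`; here the cross product is replaced by `Submodule.exists_le_ker_of_lt_top` + `finrank`.) -/
theorem cone_eq_of_hyperplane {k : Type} [Field k] {N n : ℕ} (S : MvPowerSeries (Fin N) k) (d : ℕ)
    (cv : Fin n → (Fin N → k)) (hli : LinearIndependent k cv) (hn : n + 1 = N)
    (hinv : ∀ (j : Fin n) (v : Fin N → k), CobordantChart.initEval (fun _ : Fin N => 1) (v + cv j) d S =
      CobordantChart.initEval (fun _ : Fin N => 1) v d S) :
    ∃ (la : k) (ℓ : Fin N → k), ℓ ≠ 0 ∧ (∀ j, dotProduct ℓ (cv j) = 0) ∧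
      ∀ v : Fin N → k, CobordantChart.initEval (fun _ : Fin N => 1) v d S = la * dotProduct ℓ v ^ d := by
  classical
  set U : Submodule k (Fin N → k) := Submodule.span k (Set.range cv) with hUdef
  have hU : Module.finrank k U = n := by
    rw [hUdef, finrank_span_eq_card hli, Fintype.card_fin]
  have hV : Module.finrank k (Fin N → k) = N := Module.finrank_fin_fun k
  have hlt : U < ⊤ := by
    refine lt_top_iff_ne_top.mpr fun htop => ?_
    have h := hU
    rw [htop, finrank_top, hV] at h
    omega
  obtain ⟨φ, hφ0, hUker⟩ := Submodule.exists_le_ker_of_lt_top U hlt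
  set ℓ : Fin N → k := fun i => φ (fun j => if i = j then 1 else 0) with hℓdef
  have hφ : ∀ v : Fin N → k, φ v = dotProduct ℓ v := by
    intro v
    rw [LinearMap.pi_apply_eq_sum_univ φ v, dotProduct_comm]
    simp only [dotProduct, smul_eq_mul, hℓdef]
  have hℓ0 : ℓ ≠ 0 := by
    intro h
    exact hφ0 (LinearMap.ext fun v => by rw [hφ v, h, zero_dotProduct, LinearMap.zero_apply])
  have hker : ∀ j, dotProduct ℓ (cv j) = 0 := fun j => by
    rw [← hφ]
    exact LinearMap.mem_ker.mp (hUker (Submodule.subset_span ⟨j, rfl⟩))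
  obtain ⟨i₀, hi₀⟩ := Function.ne_iff.mp hℓ0
  set u : Fin N → k := Pi.single i₀ (ℓ i₀)⁻¹ with hudef
  have hℓu : dotProduct ℓ u = 1 := by rw [hudef, dotProduct_single, mul_inv_cancel₀ hi₀]
  have hkerU : LinearMap.ker φ = U := by
    refine (Submodule.eq_of_le_of_finrank_le hUker ?_).symm
    have hne : LinearMap.ker φ ≠ ⊤ := fun h => hφ0 (LinearMap.ker_eq_top.mp h)
    have hk := Submodule.finrank_lt hne
    rw [hV] at hk
    omega
  have hdec : ∀ v : Fin N → k, ∃ x : Fin n → k, v = dotProduct ℓ v • u + ∑ j, x j • cv j := by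
    intro v
    have hw : v - dotProduct ℓ v • u ∈ U := by
      rw [← hkerU, LinearMap.mem_ker, map_sub, map_smul, hφ u, hℓu, smul_eq_mul, mul_one, hφ v, sub_self]
    obtain ⟨x, hx⟩ := (Submodule.mem_span_range_iff_exists_fun k).mp hw
    exact ⟨x, by rw [hx, add_sub_cancel]⟩
  refine ⟨CobordantChart.initEval (fun _ : Fin N => 1) u d S, ℓ, hℓ0, hker, fun v => ?_⟩
  obtain ⟨x, hx⟩ := hdec v
  have hsum : ∀ (w : Fin N → k) (s : Finset (Fin n)),
      CobordantChart.initEval (fun _ : Fin N => 1) (w + ∑ j ∈ s, x j • cv j) d S =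
        CobordantChart.initEval (fun _ : Fin N => 1) w d S := by
    intro w s
    refine Finset.induction_on s ?_ (fun a s ha ih => ?_)
    · rw [Finset.sum_empty, add_zero]
    · rw [Finset.sum_insert ha, add_comm (x a • cv a), ← add_assoc, AxisNormalize.initEval_add_smul (hinv a), ih]
  conv_lhs => rw [hx]
  rw [hsum, AxisNormalize.initEval_smul, mul_comm]

/-- **A UNARY VERTEX HAS A DIRECTRIX FORM** (every `m`, admissible state with `o ≥ 1`): `in_c(f̃)(v) = λ · (ℓ · v)^c` with `ℓ ≠ 0`, `λ ≠ 0`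
(`λ ≠ 0` because a germ of order exactly `c > 0` is not invariant under every translation, `TOT2Near.order_ne_of_forall_inv` + `Decoration.order_totalO`). -/
theorem Decoration.exists_isDirForm_of_unaryVertex {k : Type} [Field k] [Infinite k] {m : ℕ} {b : MvPowerSeries (Fin (m + 1)) k} {δ : Decoration k m}
    (hadm : Admissible b δ) (ho : 1 ≤ δ.o) (hU : UnaryVertex δ) : ∃ ℓ : Fin (m + 1) → k, δ.IsDirForm ℓ := by
  obtain ⟨cv, hli, hinv⟩ := hU
  obtain ⟨la, ℓ, hℓ, -, hcone⟩ := cone_eq_of_hyperplane (δ.f * ∏ l ∈ δ.O, X l) δ.c cv hli rfl (fun j v => hinv j v)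
  refine ⟨ℓ, hℓ, la, ?_, hcone⟩
  intro hla
  have hc : 0 < δ.c := by unfold Decoration.c; omega
  refine TOT2Near.order_ne_of_forall_inv hc (f := δ.f * ∏ l ∈ δ.O, X l) (fun u v => ?_)
    (by rw [Decoration.order_totalO hadm])
  rw [hcone, hcone, hla, zero_mul, zero_mul]

/-- **POSITION TRICHOTOMY**: given a directrix form and `O = ∅`, the state is in GOOD, LETTER or BAD position (tree definitions, every `m`). -/
theorem Decoration.position_trichotomy {k : Type} [Field k] {m : ℕ} {δ : Decoration k m} (hO : δ.O = ∅) {ℓ : Fin (m + 1) → k}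
    (hℓ : δ.IsDirForm ℓ) : δ.GoodDir ∨ (∃ l, δ.LetterDir l) ∨ δ.BadDir := by
  classical
  by_cases hg : ∃ j, j ∉ δ.E ∧ ℓ j ≠ 0
  · obtain ⟨j, hj, hℓj⟩ := hg
    exact Or.inl ⟨hO, ℓ, hℓ, j, hj, hℓj⟩
  · have hsupp : ∀ j, ℓ j ≠ 0 → j ∈ δ.E := fun j hj => by
      by_contra h
      exact hg ⟨j, h, hj⟩
    by_cases htwo : ∃ j j' : Fin (m + 1), j ≠ j' ∧ ℓ j ≠ 0 ∧ ℓ j' ≠ 0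
    · exact Or.inr (Or.inr ⟨hO, ℓ, hℓ, hsupp, htwo⟩)
    · obtain ⟨l, hl⟩ := Function.ne_iff.mp hℓ.1
      have hothers : ∀ j, j ≠ l → ℓ j = 0 := fun j hj => by
        by_contra h
        exact htwo ⟨j, l, hj, h, hl⟩
      exact Or.inr (Or.inl ⟨l, hO, hsupp l hl, Decoration.isDirForm_single_of_support hℓ hothers⟩)

end TameFourTupleDrop

end Summit.ResolutionOfSingularities.ResolutionOfSingularities.Theorems
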